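import Mathlib
import HarnessLib
import Literature.MathematicalPhysics.QuantumFieldTheory.ConstructiveQFTWave0
import Literature.MathematicalPhysics.QuantumLattice.AbelianFieldTensor
import Literature.MathematicalPhysics.QuantumLattice.AbelianMagneticFlux
import Summits.Ventures.LatticeQCDFlow.Scaling.CircleBallVolume
import Summits.Ventures.LatticeQCDFlow.Scaling.TopologicalCollar
import Summits.Ventures.LatticeQCDFlow.Scaling.FluxSectorCollar
import Summits.Ventures.LatticeQCDFlow.Scaling.SectorConfinement

/-!
# LatticeQCDFlow / Scaling — `ε`-sectors refine flux sectors, and the slice twist: a thin sector-changing update on a wrapping line (v3.4, (C7b″), part 1 of 2)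

HONEST FRAMING: exact (Metropolis-corrected) sampling algorithms for lattice gauge theory; figures
of merit are autocorrelation/cost numbers at stated couplings and volumes; no continuum-physics
claim.

THEORY-2.md §4 (C7), §5.13–§5.15.  The metric tunnelling laws of this directory
(`MetricTunnellingSectors.lean`, `SparsePatchSectorsLattice*.lean`, `ExposedPatchSectors*.lean`,
`GaugeFixedPatchSectors*.lean`, `BoxPatchSectors.lean`) price a `μ`-invariant Markov kernel that
updates only the links of a set `Λ` by the prior mass of ONE `c`-THICK PLAQUETTE touching `Λ`:
`(μ ⊗ κ){ε-sector changes} ≤ 2·μ{∃ p touching Λ, dist(U_p, 1) ≥ c}`, for thresholds `c = c(Λ)`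
that decay with the size of `Λ` (`c·2·4^{2l-4} ≤ ρ` for a solid box of side `l`,
`Lattice.compProd_sector_ne_le_of_box`).  This file and its sequel `SliceTwistPair.lean` settle two
points left open there, for the compact abelian group `U(1) = Circle`:

* **§1 `ε`-sectors refine flux sectors** (`topCharge_eq_of_mem_connectedComponentIn`, every `d`,
  every `L ≥ 1`, every `ε ≤ 2`): two configurations in the same connected component of the
  `ε`-thin set `{W | ∀ p, dist(W_p, 1) < ε}` have the same Lüscher flux charge
  `Q_{μν}(x₀) = φ_{μν}(x₀)/2π ∈ ℤ` through every coordinate plane — the metric sectors of the laws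
  above are at least as fine as the topological sectors (the `U(1)` form of the labelling remark in
  `BarriersTunnelling.lean`; mechanism: a component is preconnected, no thin plaquette is `-1`, and
  the integer charge is continuous off the defect set, `topCharge_comp_eq_of_preconnected` of
  `SectorConfinement.lean`).
* **§2 the slice twist** (`d = 2`): `sliceTwist L` multiplies the `L` direction-`0` links based on
  the line `{x | x 0 = 0}` — the WRAPPING update set `sliceLinks L` — by the character
  `x ↦ e^{2πi x₁/L}` (`ZMod.toCircle`) and is `1` elsewhere.  Every plaquette of `sliceTwist L` is
  `1` or `e^{∓2πi/L}`, hence `2π/L`-thin (`dist_plaquetteHolonomy_sliceTwist_le`), while its charge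
  is `topCharge 0 0 1 (sliceTwist L) = -1 ≠ 0 = topCharge 0 0 1 1` (`topCharge_sliceTwist`, `3 ≤ L`).
* **§3** for `2π/L < ε ≤ 2` the trivial configuration and the slice twist are two `ε`-thin
  configurations that AGREE OFF `sliceLinks L` and lie in DIFFERENT `ε`-sectors
  (`exists_thin_pair_sector_ne`): the sector-change event of the metric laws is not empty, and a
  `2π/L`-thin update of `L` links on a wrapping line changes the sector.  The sequel turns this pair
  into a `μ`-invariant Markov pair and records the threshold-necessity statement
  (`not_thinPlaquetteLaw_sliceLinks`).

SCOPE (honest reading).  (i) Nothing here excludes a tunnelling law for `sliceLinks L` with an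
`L`-dependent threshold (e.g. `c ≲ 1/L²`, which the sharp `U(1)` patch law of `FluxTunnelling.lean`,
`Σ_P |F| ≥ π` at `U` or `U'`, provides); the witness shows that a sector-separating threshold on a
wrapping line of `L` links is at most `2 sin(π/L)`.  (ii) The analogous thin sector-changing update
supported in a contractible BOX of side `L_w` — the winding transformation of
[cite: AlbandeaEtAl2021, §3, `Ω^±(x_n) = e^{±iπn/(2L_w)}` on the boundary of `S_w`, boundary
plaquettes changed by `±π/(2L_w)`, `⟨ΔS⟩ ≃ βπ²/(2L_w)`] — is not formalised here; it exhibits the same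
`O(1/size)` ceiling for boxes, far above the proven box threshold `ρ/(2·4^{2l-4})`.  (iii) The
`SU(N)`, `d = 4` analogue (a degree-one map `T³ → SU(2)` twisting the temporal links of one time
slice, plaquettes `O(1/L)`-thin, Lüscher charge changed by the degree) is not formalised.
-/

noncomputable section

namespace Summit.Ventures.LatticeQCDFlow.Theory2.Lattice.Flux

open MeasureTheory ProbabilityTheory Metric Set Filter Topology Real
open scoped ENNReal
open Literature.MathematicalPhysics.QuantumFieldTheory Literature.MathematicalPhysics.QuantumLattice
/-! ## §1. `ε`-sectors refine flux sectors (`U(1)`, every `d`) -/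

section Label

variable {d L : ℕ} [NeZero L]

omit [NeZero L] in
/-- An `ε`-thin configuration with `ε ≤ 2` has no exactly anti-aligned `(μ,ν)`-plaquette: it lies
off the defect set `collar μ ν 0` (chordally, `dist(-1, 1) = 2`). [folklore] -/
theorem not_mem_collar_zero_of_thin {ε : ℝ} (hε : ε ≤ 2) {μ ν : Fin d} (hμν : μ < ν)
    {W : GaugeConfig d L Circle}
    (hW : ∀ p : Plaquette d L, dist (plaquetteHolonomy W p.1 p.2.1.1 p.2.1.2) 1 < ε) :
    W ∉ collar μ ν 0 := by
  rintro ⟨x, hx⟩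
  have h1 : dist (plaquetteHolonomy W x μ ν) 1 < ε := hW ⟨x, ⟨(μ, ν), hμν⟩⟩
  rw [U1.dist_eq_norm_coe, Circle.coe_one] at h1
  set z : ℂ := ((plaquetteHolonomy W x μ ν : Circle) : ℂ) with hz
  have h2 : (2 : ℝ) ≤ ‖z - 1‖ + ‖z + 1‖ := by
    have h := norm_sub_le (z + 1) (z - 1)
    have e : z + 1 - (z - 1) = 2 := by ring
    rw [e, Complex.norm_two] at h
    linarith
  linarith [norm_nonneg (z + 1)]

/-- **`ε`-sectors refine flux sectors.**  Two `U(1)` configurations in the same connected component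
of the `ε`-thin set, `ε ≤ 2`, have the same flux charge through every coordinate plane: the metric
sectors of the tunnelling laws are at least as fine as Lüscher's topological sectors.
[cite: Luscher1999AbelianChiral, §2.2] [folklore] -/
theorem topCharge_eq_of_mem_connectedComponentIn {ε : ℝ} (hε : ε ≤ 2) (x₀ : Site d L)
    {μ ν : Fin d} (hμν : μ < ν) {U U' : GaugeConfig d L Circle}
    (h : U' ∈ connectedComponentIn
      {W : GaugeConfig d L Circle | ∀ p : Plaquette d L,
        dist (plaquetteHolonomy W p.1 p.2.1.1 p.2.1.2) 1 < ε} U) :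
    topCharge x₀ μ ν U' = topCharge x₀ μ ν U := by
  set A := {W : GaugeConfig d L Circle | ∀ p : Plaquette d L,
      dist (plaquetteHolonomy W p.1 p.2.1.1 p.2.1.2) 1 < ε} with hA
  have hUA : U ∈ A := connectedComponentIn_nonempty_iff.mp ⟨U', h⟩
  haveI : PreconnectedSpace (connectedComponentIn A U) :=
    isPreconnected_iff_preconnectedSpace.mp isPreconnected_connectedComponentIn
  have hD : ∀ y : connectedComponentIn A U, (y : GaugeConfig d L Circle) ∉ collar μ ν 0 :=
    fun y => not_mem_collar_zero_of_thin hε hμν (connectedComponentIn_subset A U y.2)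
  exact topCharge_comp_eq_of_preconnected (Y := connectedComponentIn A U)
    continuous_subtype_val x₀ hD ⟨U', h⟩ ⟨U, mem_connectedComponentIn hUA⟩

omit [NeZero L] in
/-- The trivial configuration has trivial plaquettes. [folklore] -/
theorem plaquetteHolonomy_one' {G : Type*} [Group G] (x : Site d L) (i j : Fin d) :
    plaquetteHolonomy (1 : GaugeConfig d L G) x i j = 1 := by
  simp [plaquetteHolonomy]

/-- The trivial configuration has flux charge `0` through every plane. [folklore] -/
theorem topCharge_one' (x₀ : Site d L) (μ ν : Fin d) :
    topCharge x₀ μ ν (1 : GaugeConfig d L Circle) = 0 := by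
  simp [topCharge, magneticFlux, abelianFieldTensor, plaquetteHolonomy_one']

end Label

/-! ## §2. The slice twist (`d = 2`): thin plaquettes, charge `-1` -/

section Twist

variable {L : ℕ} [NeZero L]

/-- The `ε`-thin (admissible) set of the metric tunnelling laws in `d = 2`: every plaquette within
chordal distance `ε` of `1` (verbatim the set of `Lattice.compProd_sector_ne_le_of_box`). [folklore] -/
def Thin (L : ℕ) (ε : ℝ) : Set (GaugeConfig 2 L Circle) :=
  {W | ∀ p : Plaquette 2 L, dist (plaquetteHolonomy W p.1 p.2.1.1 p.2.1.2) 1 < ε}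

/-- The wrapping update set: the `L` direction-`0` links based on the line `{x | x 0 = 0}` (it winds
once around the `1`-cycle of the torus). [folklore] -/
def sliceLinks (L : ℕ) : Set (Edge 2 L) :=
  {e | e.2 = 0 ∧ e.1 0 = 0}

/-- **The slice twist**: the direction-`0` link at `x = (0, x₁)` carries the character value
`e^{2πi x₁/L}` (`ZMod.toCircle x₁`); every other link is `1`.  The lattice form of "half" a large
gauge transformation of winding number one — a vacuum-to-vacuum transition compressed to one time
step. [cite: AlbandeaEtAl2021, §3] [folklore] -/
def sliceTwist (L : ℕ) [NeZero L] : GaugeConfig 2 L Circle :=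
  fun e => if e.2 = 0 ∧ e.1 0 = 0 then ZMod.toCircle (e.1 1) else 1

/-- Off the wrapping line the slice twist is trivial. [folklore] -/
theorem sliceTwist_apply_of_not_mem {e : Edge 2 L} (he : e ∉ sliceLinks L) : sliceTwist L e = 1 :=
  if_neg he

omit [NeZero L] in
/-- In two dimensions every (oriented) plaquette is a `(0,1)`-plaquette. [folklore] -/
theorem plaquette_dirs_eq (p : Plaquette 2 L) : p.2.1.1 = 0 ∧ p.2.1.2 = 1 := by
  have h : (p.2.1.1 : ℕ) < p.2.1.2 := p.2.2
  have h1 : (p.2.1.1 : ℕ) < 2 := p.2.1.1.isLt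
  have h2 : (p.2.1.2 : ℕ) < 2 := p.2.1.2.isLt
  refine ⟨Fin.ext ?_, Fin.ext ?_⟩
  · simp only [Fin.val_zero]; omega
  · simp only [Fin.val_one]; omega

/-- The plaquettes of the slice twist: `e^{-2πi/L}` on the twisted line, `1` elsewhere. [folklore] -/
theorem plaquetteHolonomy_sliceTwist (x : Site 2 L) :
    plaquetteHolonomy (sliceTwist L) x 0 1 =
      if x 0 = 0 then (ZMod.toCircle (1 : ZMod L))⁻¹ else 1 := by
  have h10 : (x.shift 1) 0 = x 0 := by simp [Site.shift]
  have h11 : (x.shift 1) 1 = x 1 + 1 := by simp [Site.shift]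
  have e2 : sliceTwist L (x.shift 0, 1) = 1 := if_neg (by simp)
  have e4 : sliceTwist L (x, 1) = 1 := if_neg (by simp)
  by_cases hx : x 0 = 0
  · have e1 : sliceTwist L (x, 0) = ZMod.toCircle (x 1) := if_pos ⟨rfl, hx⟩
    have e3 : sliceTwist L (x.shift 1, 0) = ZMod.toCircle (x 1 + 1) := by
      rw [← h11]; exact if_pos ⟨rfl, h10.trans hx⟩
    rw [plaquetteHolonomy, e1, e2, e3, e4, if_pos hx, AddChar.map_add_eq_mul, inv_one, mul_one,
      mul_one, mul_comm (ZMod.toCircle (x 1)) (ZMod.toCircle 1), mul_inv_rev, mul_inv_cancel_left]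
  · have e1 : sliceTwist L (x, 0) = 1 := if_neg fun h => hx h.2
    have e3 : sliceTwist L (x.shift 1, 0) = 1 := if_neg fun h => hx (h10.symm.trans h.2)
    rw [plaquetteHolonomy, e1, e2, e3, e4, if_neg hx]
    simp

/-- The elementary character value is `e^{2πi/L}`. [folklore] -/
theorem toCircle_one_eq_exp : ZMod.toCircle (1 : ZMod L) = Circle.exp (2 * π / L) := by
  apply Circle.ext
  have h := ZMod.toCircle_natCast (N := L) 1
  simp only [Nat.cast_one] at h
  rw [h, Circle.coe_exp]
  congr 1
  push_cast
  ring

/-- `dist(e^{2πi/L}, 1) = 2 sin(π/L) ≤ 2π/L`. [folklore] -/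
theorem dist_toCircle_one_le : dist (ZMod.toCircle (1 : ZMod L)) 1 ≤ 2 * π / L := by
  rw [toCircle_one_eq_exp, ← mul_one (Circle.exp (2 * π / L)), Circle.dist_exp_mul_self,
    show 2 * π / (L : ℝ) / 2 = π / L by ring, abs_mul, abs_two]
  calc 2 * |Real.sin (π / L)| ≤ 2 * |π / (L : ℝ)| :=
        mul_le_mul_of_nonneg_left Real.abs_sin_le_abs (by norm_num)
    _ = 2 * π / L := by rw [abs_of_nonneg (by positivity)]; ring

/-- **Every plaquette of the slice twist is `2π/L`-thin.** [folklore] -/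
theorem dist_plaquetteHolonomy_sliceTwist_le (p : Plaquette 2 L) :
    dist (plaquetteHolonomy (sliceTwist L) p.1 p.2.1.1 p.2.1.2) 1 ≤ 2 * π / L := by
  obtain ⟨h0, h1⟩ := plaquette_dirs_eq p
  rw [h0, h1, plaquetteHolonomy_sliceTwist]
  split_ifs
  · rw [← Circle.dist_inv_inv, inv_inv, inv_one]
    exact dist_toCircle_one_le
  · rw [dist_self]; positivity

/-- The field tensor of the slice twist: `-2π/L` on the twisted line, `0` elsewhere (`3 ≤ L` puts
`-2π/L` in the principal branch). [folklore] -/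
theorem abelianFieldTensor_sliceTwist (hL : 3 ≤ L) (y : Site 2 L) :
    abelianFieldTensor (sliceTwist L) y 0 1 = if y 0 = 0 then -(2 * π / L) else 0 := by
  rw [abelianFieldTensor, plaquetteHolonomy_sliceTwist]
  split_ifs with hy
  · have hLpos : (0 : ℝ) < L := by exact_mod_cast (show 0 < L by omega)
    have hL3 : (3 : ℝ) ≤ L := by exact_mod_cast hL
    rw [toCircle_one_eq_exp, Circle.coe_inv, Circle.coe_exp, ← Complex.exp_neg,
      show -(((2 * π / L : ℝ) : ℂ) * Complex.I) = ((-(2 * π / L) : ℝ) : ℂ) * Complex.I by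
        push_cast; ring,
      Complex.arg_exp_mul_I, toIocMod_eq_self]
    have hπ3 : π * 3 ≤ π * L := mul_le_mul_of_nonneg_left hL3 Real.pi_pos.le
    constructor
    · have : 2 * π / (L : ℝ) < π := by
        rw [div_lt_iff₀ hLpos]; linarith [Real.pi_pos]
      linarith
    · have : 0 < 2 * π / (L : ℝ) := by positivity
      linarith [Real.pi_pos]
  · rw [Circle.coe_one, Complex.arg_one]

/-- **The slice twist has flux charge `-1`** (`L` plaquettes of field tensor `-2π/L`). [folklore] -/
theorem topCharge_sliceTwist (hL : 3 ≤ L) : topCharge (0 : Site 2 L) 0 1 (sliceTwist L) = -1 := by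
  have hLne : (L : ℝ) ≠ 0 := by exact_mod_cast (show L ≠ 0 by omega)
  have hcoord : ∀ s t : ZMod L,
      ((0 : Site 2 L) + Pi.single (0 : Fin 2) s + Pi.single (1 : Fin 2) t : Site 2 L) 0 = s := by
    intro s t; simp
  unfold topCharge magneticFlux
  simp only [abelianFieldTensor_sliceTwist hL, hcoord, Finset.sum_const, Finset.card_univ,
    ZMod.card, nsmul_eq_mul]
  rw [← Finset.mul_sum, Finset.sum_ite_eq' Finset.univ (0 : ZMod L), if_pos (Finset.mem_univ _)]
  field_simp

/-- The slice twist is not the trivial configuration (their charges differ). [folklore] -/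
theorem sliceTwist_ne_one (hL : 3 ≤ L) : sliceTwist L ≠ 1 := by
  intro h
  have h1 := topCharge_sliceTwist hL
  rw [h, topCharge_one'] at h1
  norm_num at h1

end Twist

/-! ## §3. Two thin configurations, agreeing off a wrapping line, in different `ε`-sectors -/

section Sectors

variable {L : ℕ} [NeZero L]

omit [NeZero L] in
/-- The trivial configuration is `ε`-thin for every `ε > 0`. [folklore] -/
theorem one_mem_thin {ε : ℝ} (hε : 0 < ε) : (1 : GaugeConfig 2 L Circle) ∈ Thin L ε := fun p => by
  rw [plaquetteHolonomy_one', dist_self]; exact hε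

/-- The slice twist is `ε`-thin for every `ε > 2π/L`. [folklore] -/
theorem sliceTwist_mem_thin {ε : ℝ} (hε : 2 * π / L < ε) : sliceTwist L ∈ Thin L ε :=
  fun p => (dist_plaquetteHolonomy_sliceTwist_le p).trans_lt hε

/-- The trivial configuration and the slice twist agree off the wrapping line. [folklore] -/
theorem one_eq_sliceTwist_of_not_mem {e : Edge 2 L} (he : e ∉ sliceLinks L) :
    (1 : GaugeConfig 2 L Circle) e = sliceTwist L e := by
  rw [sliceTwist_apply_of_not_mem he]; rfl

/-- **The slice twist is not in the `ε`-sector of the trivial configuration** (`ε ≤ 2`): the two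
have different flux charges and `ε`-sectors refine flux sectors. [folklore] -/
theorem sliceTwist_not_mem_connectedComponentIn_one (hL : 3 ≤ L) {ε : ℝ} (hε : ε ≤ 2) :
    sliceTwist L ∉ connectedComponentIn (Thin L ε) 1 := by
  intro h
  have h1 := topCharge_eq_of_mem_connectedComponentIn hε (0 : Site 2 L) (μ := 0) (ν := 1)
    (by decide) h
  rw [topCharge_sliceTwist hL, topCharge_one'] at h1
  norm_num at h1

/-- The `ε`-sectors of the trivial configuration and of the slice twist differ (`0 < ε ≤ 2`). [folklore] -/
theorem connectedComponentIn_one_ne_sliceTwist (hL : 3 ≤ L) {ε : ℝ} (hε0 : 0 < ε) (hε : ε ≤ 2) :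
    connectedComponentIn (Thin L ε) 1 ≠ connectedComponentIn (Thin L ε) (sliceTwist L) := by
  intro h
  have h1 : (1 : GaugeConfig 2 L Circle) ∈ connectedComponentIn (Thin L ε) (sliceTwist L) := by
    rw [← h]; exact mem_connectedComponentIn (one_mem_thin hε0)
  have h2 : sliceTwist L ∈ Thin L ε := connectedComponentIn_nonempty_iff.mp ⟨1, h1⟩
  have h3 : sliceTwist L ∈ connectedComponentIn (Thin L ε) 1 := by
    rw [h]; exact mem_connectedComponentIn h2
  exact sliceTwist_not_mem_connectedComponentIn_one hL hε h3

/-- **Non-vacuity of the sector-change event on a wrapping line.**  For `3 ≤ L` and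
`2π/L < ε ≤ 2` there are two `ε`-thin configurations agreeing off the `L` links of `sliceLinks L` and
lying in different `ε`-sectors. [folklore] -/
theorem exists_thin_pair_sector_ne (hL : 3 ≤ L) {ε : ℝ} (hε : 2 * π / L < ε) (hε2 : ε ≤ 2) :
    ∃ U U' : GaugeConfig 2 L Circle, U ∈ Thin L ε ∧ U' ∈ Thin L ε ∧
      (∀ e ∉ sliceLinks L, U e = U' e) ∧
      connectedComponentIn (Thin L ε) U ≠ connectedComponentIn (Thin L ε) U' :=
  have hε0 : 0 < ε := lt_of_le_of_lt (by positivity) hε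
  ⟨1, sliceTwist L, one_mem_thin hε0, sliceTwist_mem_thin hε, fun _ he =>
    one_eq_sliceTwist_of_not_mem he, connectedComponentIn_one_ne_sliceTwist hL hε0 hε2⟩

end Sectors

end Summit.Ventures.LatticeQCDFlow.Theory2.Lattice.Flux
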